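import Summits.MatrixMultiplication.OmegaCensus.USPClassifyRefute
import HarnessLib

/-!
# ω-census, family (b′) STPP / USP: kernel kit for classifying (strong) USPs of width 4 — III: the level checker and its soundness

HONEST FRAMING (pub-omega census; verbatim): lottery ticket; floor = certified bounds/negative ranges.
Census BOOKKEEPING machinery; no value of `ω` is touched here.  Continues `USPClassifyRefute.lean`.

The checker.  A level `s → s + 1` has: the classes of level `s` (`N` of them, packed in `CLS`), those of level `s + 1` (`Nn`, `CLSn`),
a witness table `WT` (`NW` pairs of permutations of `s + 1` rows), the pair table `PTab`, and a certificate = one numeral per chunk of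
16 classes, read least-significant-bits first.  For class `R` and each code `r = 0 … 80` not in `R`'s skip mask (`skipMask`: members of
`R` and codes making a tabulated bad pair with a member) one entry is consumed (`stepEntry`): kind bit `0` + a witness index
(`rdIdx`: a `b`-bit field, all-ones escaping to 11 more bits) whose witness must refute the candidate `r :: R` (`refWP`), or kind bit
`1` + `(p, q)` (3 + 5 bits) + a class index `j` (`jb` bits) with the image of `r :: R` under `(p, q)` equal as a SET to class `j` of
the next level (bit masks, `imgMask = maskOf`).  `chunkPass` demands exact consumption of a chunk numeral down to a sentinel `1`;
`checkChunks` checks a range of chunks (a level is split into several kernel computations), `checkHdr` the witness table, the shape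
of the next-level classes and the chunk coverage.

Soundness (`classified_succ`): from `Classified st s` (level `s`), a correct pair table, well-formed classes and passing checks,
every `(s+1)`-row (strong) USP list `x :: C` is handled — move `C` onto a listed class `R` by the inductive word, let `r` be the image
of `x`; the certified alternative for `(R, r)` either contradicts the puzzle property of a sub-list (`PZ.subset`, `not_pz_of_refW`,
`not_pz_of_badPairB`) or extends the word by `(p, q)` onto a class of level `s + 1`.
-/

namespace Summit.MatrixMultiplication.OmegaCensus

open Literature.Computability.AlgebraicComplexity Equiv

namespace W4

/-- The bit mask `⋃_{u<n} {cd P u}` of the first `n` codes of a packed list. [folklore] -/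
def maskOf (P n : ℕ) : ℕ := bitsOf (cd P) n

/-- The packed refutation test: every row `u < n` moved by `σ` or `τ` gives a silent code triple. [folklore] -/
def refWP (st : Bool) (n P w : ℕ) : Bool :=
  allBelow n fun u => (sg w u == u && tg w u == u) || silent st (cd P u) (cd P (sg w u)) (cd P (tg w u))

/-- The packed test implies the list test on the decoded codes (for a valid witness, whose values stay `< n`). [folklore] -/
theorem refW_of_refWP {st : Bool} {n P w : ℕ} (hv : validWit n w = true) (h : refWP st n P w = true) :
    refW st (codesOf P n) w = true := by
  rw [refWP, allBelow_iff] at h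
  simp only [validWit, Bool.and_eq_true] at hv
  obtain ⟨⟨⟨hlt, -⟩, -⟩, -⟩ := hv
  rw [allBelow_iff] at hlt
  simp only [refW, List.all_eq_true, List.mem_range, length_codesOf]
  intro u hu
  have hb := hlt u hu
  simp only [Bool.and_eq_true, decide_eq_true_eq] at hb
  have h' := h u hu
  rw [getD_codesOf hu, getD_codesOf hb.1, getD_codesOf hb.2]
  exact h'

/-- The bit mask of the `(p, q)`-images of the first `n` codes of `P`. [folklore] -/
def imgMask (p q P n : ℕ) : ℕ := bitsOf (fun u => actCode p q (cd P u)) n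

/-- Equal masks: the image set is the target set. [folklore] -/
theorem mem_iff_of_masks {p q P T n : ℕ} (h : imgMask p q P n = maskOf T n) (y : ℕ) :
    y ∈ (codesOf P n).map (actCode p q) ↔ y ∈ codesOf T n := by
  have h1 : y ∈ (codesOf P n).map (actCode p q) ↔ ∃ u < n, actCode p q (cd P u) = y := by
    simp [codesOf, List.mem_map, List.mem_range]
  rw [h1]
  unfold imgMask maskOf at h
  rw [← testBit_bitsOf, h, testBit_bitsOf, mem_codesOf]

/-- Read a witness index from the stream: a `b`-bit field, the all-ones value escaping to 11 further bits; returns the index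
and the rest of the stream. [folklore] -/
def rdIdx (x1 b : ℕ) : ℕ × ℕ :=
  if x1 &&& (2 ^ b - 1) = 2 ^ b - 1 then (2 ^ b - 1 + ((x1 >>> b) &&& 2047), (x1 >>> b) >>> 11) else (x1 &&& (2 ^ b - 1), x1 >>> b)

/-- Consume one certificate entry for the candidate whose packed codes are `P` (`n` codes: the new code `r` first, then the class):
kind bit `0` = refutation by witness number `idx` (`rdIdx`) of the table `WT` (`NW` entries), kind bit `1` = group element `(p, q)`
(3 + 5 bits) and target class `j` (`jb` bits) among the `Nn` classes of the next level `CLSn`.  `none` = the entry does not check.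
[folklore] -/
def stepEntry (st : Bool) (n P WT NW CLSn Nn b jb x : ℕ) : Option ℕ :=
  if x % 2 = 0 then
    (if (rdIdx (x >>> 1) b).1 < NW ∧ refWP st n P (getWitP WT (rdIdx (x >>> 1) b).1) = true then some (rdIdx (x >>> 1) b).2
     else none)
  else
    (if (x >>> 1) &&& 7 < 6 ∧ (x >>> 4) &&& 31 < 24 ∧ (x >>> 9) &&& (2 ^ jb - 1) < Nn ∧
        imgMask ((x >>> 1) &&& 7) ((x >>> 4) &&& 31) P n = maskOf (getClassP CLSn n ((x >>> 9) &&& (2 ^ jb - 1))) n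
     then some (x >>> (9 + jb)) else none)

/-- The candidate codes `r = 80 − k, …, 80` for the class with packed codes `R` (`s` codes), skip mask `K` (bit `r` set = nothing to
consume: `r ∈ R` or a tabulated bad pair), stream `x`. [folklore] -/
def rLoop (st : Bool) (s R K WT NW CLSn Nn b jb : ℕ) : ℕ → ℕ → Option ℕ
  | 0, x => some x
  | k + 1, x =>
    if K.testBit (80 - k) then rLoop st s R K WT NW CLSn Nn b jb k x
    else match stepEntry st (s + 1) ((80 - k) ||| (R <<< 7)) WT NW CLSn Nn b jb x with
      | none => none
      | some x' => rLoop st s R K WT NW CLSn Nn b jb k x'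

/-- The skip mask of a class: its own codes and every code making a tabulated bad pair with one of them (row `y` of the
`81 × 81` pair table is its bits `81y … 81y + 80`). [folklore] -/
def skipMask (PTab R : ℕ) : ℕ → ℕ
  | 0 => 0
  | m + 1 => skipMask PTab R m ||| (1 <<< cd R m) ||| ((PTab >>> (81 * cd R m)) &&& (2 ^ 81 - 1))

/-- What a set bit of the skip mask means. [folklore] -/
theorem testBit_skipMask {PTab R r : ℕ} (hr : r < 81) :
    ∀ m, (skipMask PTab R m).testBit r = true → ∃ u < m, cd R u = r ∨ PTab.testBit (81 * cd R u + r) = true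
  | 0, h => by simp [skipMask] at h
  | m + 1, h => by
    rw [skipMask, Nat.testBit_or, Nat.testBit_or, Bool.or_eq_true, Bool.or_eq_true] at h
    rcases h with (h | h) | h
    · obtain ⟨u, hu, h'⟩ := testBit_skipMask hr m h
      exact ⟨u, Nat.lt_succ_of_lt hu, h'⟩
    · rw [Nat.shiftLeft_eq, Nat.one_mul, Nat.testBit_two_pow, decide_eq_true_eq] at h
      exact ⟨m, Nat.lt_succ_self m, Or.inl h⟩
    · rw [Nat.testBit_and, Bool.and_eq_true, Nat.testBit_shiftRight] at h
      exact ⟨m, Nat.lt_succ_self m, Or.inr h.1⟩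

/-- Process class number `j` of the level (stream in, stream out). [folklore] -/
def classPass (st : Bool) (s CLS PTab WT NW CLSn Nn b jb j x : ℕ) : Option ℕ :=
  rLoop st s (getClassP CLS s j) (skipMask PTab (getClassP CLS s j) s) WT NW CLSn Nn b jb 81 x

/-- Fold step over the 16 classes of chunk `t`. [folklore] -/
def stepC (st : Bool) (s CLS N PTab WT NW CLSn Nn b jb t : ℕ) : Option ℕ → ℕ → Option ℕ
  | none, _ => none
  | some x, k => if 16 * t + k < N then classPass st s CLS PTab WT NW CLSn Nn b jb (16 * t + k) x else some x

/-- Chunk `t` of the certificate: its numeral is consumed exactly (down to the sentinel `1`) by its 16 classes. [folklore] -/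
def chunkPass (st : Bool) (s CLS N PTab WT NW CLSn Nn b jb : ℕ) (CERT : List ℕ) (t : ℕ) : Bool :=
  ((List.range 16).foldl (stepC st s CLS N PTab WT NW CLSn Nn b jb t) (some (CERT.getD t 0))) == some 1

/-- Chunks `a, …, a + k − 1` of the certificate pass (a level is checked in several such parts, each its own kernel
computation). [folklore] -/
def checkChunks (st : Bool) (s CLS N PTab WT NW CLSn Nn b jb : ℕ) (CERT : List ℕ) (a k : ℕ) : Bool :=
  allBelow k fun i => chunkPass st s CLS N PTab WT NW CLSn Nn b jb CERT (a + i)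

/-- Header checks of a level: all `N` classes are covered by the `nch` chunks, the witness table is valid for `s + 1` rows, the
next-level classes are well formed. [folklore] -/
def checkHdr (s N CLSn Nn WT NW nch : ℕ) : Bool :=
  decide (N ≤ 16 * nch) && allBelow NW (fun k => validWit (s + 1) (getWitP WT k)) &&
    allBelow Nn (fun j => goodClassP (getClassP CLSn (s + 1) j) (s + 1))

/-- Reading a part: every chunk in its range passes. [folklore] -/
theorem chunkPass_of_checkChunks {st : Bool} {s CLS N PTab WT NW CLSn Nn b jb : ℕ} {CERT : List ℕ} {a k : ℕ}
    (h : checkChunks st s CLS N PTab WT NW CLSn Nn b jb CERT a k = true) {t : ℕ} (h1 : a ≤ t) (h2 : t < a + k) :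
    chunkPass st s CLS N PTab WT NW CLSn Nn b jb CERT t = true := by
  rw [checkChunks, allBelow_iff] at h
  have := h (t - a) (by omega)
  rwa [show a + (t - a) = t by omega] at this

/-! ## Soundness of the level checker -/

/-- Folding a `none`-absorbing `Option`-state step: if the result is `some`, every element met a `some` state and passed. [folklore] -/
theorem foldl_some {f : Option ℕ → ℕ → Option ℕ} (hf : ∀ k, f none k = none) :
    ∀ (l : List ℕ) (o : Option ℕ), (l.foldl f o).isSome = true → ∀ k ∈ l, ∃ x : ℕ, (f (some x) k).isSome = true := by
  have hnone : ∀ l : List ℕ, l.foldl f none = none := fun l => by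
    induction l with
    | nil => rfl
    | cons a l ih => rw [List.foldl_cons, hf, ih]
  intro l
  induction l with
  | nil => intro o _ k hk; simp at hk
  | cons a l ih =>
    intro o h k hk
    rw [List.foldl_cons] at h
    rcases List.mem_cons.1 hk with rfl | hk
    · cases o with
      | none => rw [hf, hnone] at h; simp at h
      | some x =>
        refine ⟨x, ?_⟩
        cases hfa : f (some x) k with
        | none => rw [hfa, hnone] at h; simp at h
        | some _ => rfl
    · exact ih _ h k hk

/-- What a passed candidate `(R, r)` certifies (`R` packed, `s` codes; the candidate is `r` followed by `R`). [folklore] -/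
def Good (st : Bool) (s R r PTab WT NW CLSn Nn : ℕ) : Prop :=
  (∃ u < s, cd R u = r ∨ PTab.testBit (81 * cd R u + r) = true) ∨
  (∃ idx < NW, refWP st (s + 1) (r ||| (R <<< 7)) (getWitP WT idx) = true) ∨
  ∃ p q j, p < 6 ∧ q < 24 ∧ j < Nn ∧ imgMask p q (r ||| (R <<< 7)) (s + 1) = maskOf (getClassP CLSn (s + 1) j) (s + 1)

/-- A successful entry step certifies the candidate. [folklore] -/
theorem good_of_stepEntry {st : Bool} {s R r WT NW CLSn Nn b jb x PTab : ℕ}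
    (h : (stepEntry st (s + 1) (r ||| (R <<< 7)) WT NW CLSn Nn b jb x).isSome = true) : Good st s R r PTab WT NW CLSn Nn := by
  unfold stepEntry at h
  by_cases h0 : x % 2 = 0
  · rw [if_pos h0] at h
    by_cases h1 : (rdIdx (x >>> 1) b).1 < NW ∧ refWP st (s + 1) (r ||| (R <<< 7)) (getWitP WT (rdIdx (x >>> 1) b).1) = true
    · exact Or.inr (Or.inl ⟨_, h1.1, h1.2⟩)
    · rw [if_neg h1] at h; exact absurd h (by simp)
  · rw [if_neg h0] at h
    by_cases h2 : (x >>> 1) &&& 7 < 6 ∧ (x >>> 4) &&& 31 < 24 ∧ (x >>> 9) &&& (2 ^ jb - 1) < Nn ∧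
        imgMask ((x >>> 1) &&& 7) ((x >>> 4) &&& 31) (r ||| (R <<< 7)) (s + 1) =
          maskOf (getClassP CLSn (s + 1) ((x >>> 9) &&& (2 ^ jb - 1))) (s + 1)
    · exact Or.inr (Or.inr ⟨_, _, _, h2.1, h2.2.1, h2.2.2.1, h2.2.2.2⟩)
    · rw [if_neg h2] at h; exact absurd h (by simp)

/-- A successful `rLoop k` certifies every candidate code `r ≥ 81 − k` (below 81). [folklore] -/
theorem good_of_rLoop {st : Bool} {s R K WT NW CLSn Nn b jb PTab : ℕ} (hK : K = skipMask PTab R s) :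
    ∀ k x, (rLoop st s R K WT NW CLSn Nn b jb k x).isSome = true → ∀ r, 81 - k ≤ r → r < 81 →
      Good st s R r PTab WT NW CLSn Nn
  | 0, x, _, r, h1, h2 => by omega
  | k + 1, x, h, r, h1, h2 => by
    rw [rLoop] at h
    by_cases hr : r = 80 - k
    · subst hr
      by_cases hb : K.testBit (80 - k) = true
      · obtain ⟨u, hu, h'⟩ := testBit_skipMask h2 s (hK ▸ hb)
        exact Or.inl ⟨u, hu, h'⟩
      · rw [if_neg hb] at h
        cases hst : stepEntry st (s + 1) ((80 - k) ||| (R <<< 7)) WT NW CLSn Nn b jb x with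
        | none => rw [hst] at h; exact absurd h (by simp)
        | some x' => exact good_of_stepEntry (by rw [hst]; rfl)
    · have hk : 81 - k ≤ r := by omega
      by_cases hb : K.testBit (80 - k) = true
      · rw [if_pos hb] at h
        exact good_of_rLoop hK k x h r hk h2
      · rw [if_neg hb] at h
        cases hst : stepEntry st (s + 1) ((80 - k) ||| (R <<< 7)) WT NW CLSn Nn b jb x with
        | none => rw [hst] at h; exact absurd h (by simp)
        | some x' =>
          rw [hst] at h
          exact good_of_rLoop hK k x' h r hk h2

/-- **Soundness of the chunk checks, candidate by candidate**: if all `N` classes are covered by passing chunks, every `(R, r)`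
with `R` a listed class and `r < 81` is certified. [folklore] -/
theorem good_of_chunks {st : Bool} {s CLS N PTab WT NW CLSn Nn b jb nch : ℕ} {CERT : List ℕ} (hN : N ≤ 16 * nch)
    (hch : ∀ t < nch, chunkPass st s CLS N PTab WT NW CLSn Nn b jb CERT t = true) {j : ℕ} (hj : j < N) {r : ℕ}
    (hr : r < 81) : Good st s (getClassP CLS s j) r PTab WT NW CLSn Nn := by
  have ht : j / 16 < nch := by omega
  have hcp := hch (j / 16) ht
  unfold chunkPass at hcp
  have hsome : ((List.range 16).foldl (stepC st s CLS N PTab WT NW CLSn Nn b jb (j / 16)) (some (CERT.getD (j / 16) 0))).isSome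
      = true := by
    rw [beq_iff_eq] at hcp; rw [hcp]; rfl
  obtain ⟨x, hx⟩ := foldl_some (fun k => rfl) _ _ hsome (j % 16) (List.mem_range.2 (Nat.mod_lt _ (by decide)))
  have hjk : 16 * (j / 16) + j % 16 = j := Nat.div_add_mod j 16
  simp only [stepC] at hx
  rw [if_pos (by omega), hjk] at hx
  unfold classPass at hx
  exact good_of_rLoop rfl 81 x hx r (by omega) hr

/-- Reading the header checks. [folklore] -/
theorem aux_of_checkHdr {s N CLSn Nn WT NW nch : ℕ} (h : checkHdr s N CLSn Nn WT NW nch = true) :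
    N ≤ 16 * nch ∧ (∀ k < NW, validWit (s + 1) (getWitP WT k) = true) ∧
      ∀ j < Nn, goodClassP (getClassP CLSn (s + 1) j) (s + 1) = true := by
  simp only [checkHdr, Bool.and_eq_true, decide_eq_true_eq] at h
  obtain ⟨⟨hN, hW⟩, hG⟩ := h
  rw [allBelow_iff] at hW hG
  exact ⟨hN, hW, hG⟩

/-- The codes of the packed candidate `r ||| (R <<< 7)`: `r` (for `r < 128`) followed by the codes of `R`. [folklore] -/
theorem cd_cand (r R : ℕ) (hr : r < 128) : cd (r ||| (R <<< 7)) 0 = r ∧ ∀ u, cd (r ||| (R <<< 7)) (u + 1) = cd R u := by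
  constructor
  · unfold cd
    apply Nat.eq_of_testBit_eq; intro i
    rw [Nat.mul_zero, Nat.shiftRight_zero, Nat.testBit_and, Nat.testBit_or, Nat.testBit_shiftLeft]
    by_cases hi : i < 7
    · have h1 : (127 : ℕ).testBit i = true := by
        have : (127 : ℕ) = 2 ^ 7 - 1 := by norm_num
        rw [this, Nat.testBit_two_pow_sub_one]; exact decide_eq_true_iff.2 hi
      have h2 : decide (i ≥ 7) = false := decide_eq_false (by omega)
      rw [h1, h2]; simp
    · have h1 : (127 : ℕ).testBit i = false := by
        have : (127 : ℕ) = 2 ^ 7 - 1 := by norm_num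
        rw [this, Nat.testBit_two_pow_sub_one]; exact decide_eq_false (by omega)
      have h128 : 128 ≤ 2 ^ i := le_trans (by norm_num : 128 ≤ 2 ^ 7) (Nat.pow_le_pow_right (by norm_num) (by omega))
      have h3 : r.testBit i = false := Nat.testBit_lt_two_pow (lt_of_lt_of_le hr h128)
      rw [h1, h3]; simp
  · intro u
    unfold cd
    apply Nat.eq_of_testBit_eq; intro i
    rw [Nat.testBit_and, Nat.testBit_and, Nat.testBit_shiftRight, Nat.testBit_shiftRight, Nat.testBit_or,
      Nat.testBit_shiftLeft]
    by_cases hi : i < 7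
    · have h128 : 128 ≤ 2 ^ (7 * (u + 1) + i) :=
        le_trans (by norm_num : 128 ≤ 2 ^ 7) (Nat.pow_le_pow_right (by norm_num) (by omega))
      have h3 : r.testBit (7 * (u + 1) + i) = false := Nat.testBit_lt_two_pow (lt_of_lt_of_le hr h128)
      have h2 : decide (7 * (u + 1) + i ≥ 7) = true := decide_eq_true (by omega)
      rw [h3, h2]
      simp only [Bool.false_or, Bool.true_and]
      congr 2; omega
    · have h1 : (127 : ℕ).testBit i = false := by
        have : (127 : ℕ) = 2 ^ 7 - 1 := by norm_num
        rw [this, Nat.testBit_two_pow_sub_one]; exact decide_eq_false (by omega)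
      rw [h1]; simp

/-- The decoded candidate is `r :: (codes of R)`. [folklore] -/
theorem codesOf_cand (r R s : ℕ) (hr : r < 128) : codesOf (r ||| (R <<< 7)) (s + 1) = r :: codesOf R s := by
  obtain ⟨h0, hs⟩ := cd_cand r R hr
  unfold codesOf
  rw [List.range_succ_eq_map, List.map_cons, List.map_map, h0]
  congr 1
  apply List.map_congr_left
  intro u _
  exact hs u

/-- **The inductive step**: a correct pair table, well-formed classes at level `s`, a passing level certificate and the
classification at level `s` give the classification at level `s + 1` (with well-formed classes).
[cite: AndersonJiXu2020, §7 (Table 3, equivalence classes; arXiv:2301.00074v1)] -/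
theorem classified_succ {st : Bool} {s CLS N CLSn Nn WT NW PTab b jb nch : ℕ} {CERT : List ℕ}
    (hT : pairTabOK st PTab = true) (hL : ∀ j < N, goodClassP (getClassP CLS s j) s = true)
    (hhdr : checkHdr s N CLSn Nn WT NW nch = true)
    (hch : ∀ t < nch, chunkPass st s CLS N PTab WT NW CLSn Nn b jb CERT t = true) (hcl : Classified st s (Lcls CLS s N)) :
    Classified st (s + 1) (Lcls CLSn (s + 1) Nn) ∧ ∀ j < Nn, goodClassP (getClassP CLSn (s + 1) j) (s + 1) = true := by
  obtain ⟨hN, hW, hG⟩ := aux_of_checkHdr hhdr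
  refine ⟨?_, hG⟩
  intro C' hlen hnd hC hP
  obtain ⟨x, C, rfl⟩ : ∃ x C, C' = x :: C := by
    cases C' with
    | nil => simp at hlen
    | cons x C => exact ⟨x, C, rfl⟩
  have hx81 : x < 81 := hC x (by simp)
  have hC81 : ∀ y ∈ C, y < 81 := fun y hy => hC y (List.mem_cons_of_mem _ hy)
  have hndC : C.Nodup := (List.nodup_cons.1 hnd).2
  have hxC : x ∉ C := (List.nodup_cons.1 hnd).1
  have hPC : PZ st C := hP.subset (fun y hy => List.mem_cons_of_mem _ hy) hndC
  obtain ⟨gs, hgs, T, hTL, hTC⟩ := hcl C (by simpa using hlen) hndC hC81 hPC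
  obtain ⟨j, hj, rfl⟩ := List.mem_map.1 hTL
  rw [List.mem_range] at hj
  obtain ⟨hTnd, hT81⟩ := goodClassP_spec (hL j hj)
  set R := getClassP CLS s j with hR
  set r := actW gs x with hr
  have hr81 : r < 81 := actW_lt hgs hx81
  -- the image of the whole puzzle and its members
  have hPD : PZ st ((x :: C).map (actW gs)) := hP.mapW hgs hC
  have hD : ∀ y, y ∈ (x :: C).map (actW gs) ↔ y = r ∨ y ∈ codesOf R s := fun y => by
    rw [List.map_cons, List.mem_cons, hTC]
  have hrT : r ∉ codesOf R s := fun hrT' => by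
    obtain ⟨y, hy, hyr⟩ := List.mem_map.1 ((hTC r).2 hrT')
    exact hxC ((actW_inj hgs (hC81 y hy) hx81 hyr) ▸ hy)
  have hsub : ∀ S : List ℕ, (∀ y ∈ S, y = r ∨ y ∈ codesOf R s) → S.Nodup → PZ st S := fun S hS hSnd =>
    hPD.subset (fun y hy => (hD y).2 (hS y hy)) hSnd
  have hcand : codesOf (r ||| (R <<< 7)) (s + 1) = r :: codesOf R s := codesOf_cand r R s (by omega)
  rcases good_of_chunks hN hch hj hr81 with ⟨u, hu, hur⟩ | ⟨idx, hidx, href⟩ | ⟨p, q, j', hp, hq, hj', hmap⟩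
  · have hyT : cd R u ∈ codesOf R s := mem_codesOf.2 ⟨u, hu, rfl⟩
    rcases hur with hur | hbit
    · exact absurd (hur ▸ hyT) hrT
    · -- a bad pair `{cd R u, r}`
      have hbad := badPairB_of_tab hT (hT81 _ hyT) hr81 hbit
      have hry : cd R u ≠ r := fun h => hrT (h ▸ hyT)
      exact absurd (hsub [cd R u, r] (by simp [hyT]) (by simp [hry])) (not_pz_of_badPairB hbad)
  · -- an explicit refutation of `r :: R`
    have hv : validWit (s + 1) (getWitP WT idx) = true := hW idx hidx
    have href' := refW_of_refWP hv href
    rw [hcand] at href'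
    have hv' : validWit (r :: codesOf R s).length (getWitP WT idx) = true := by
      rw [List.length_cons, length_codesOf]; exact hv
    exact absurd (hsub (r :: codesOf R s) (by simp) (List.nodup_cons.2 ⟨hrT, hTnd⟩)) (not_pz_of_refW hv' href')
  · -- a symmetry onto class `j'` of the next level
    refine ⟨gs ++ [(p, q)], fun g hg => ?_, codesOf (getClassP CLSn (s + 1) j') (s + 1),
      List.mem_map.2 ⟨j', List.mem_range.2 hj', rfl⟩, ?_⟩
    · rcases List.mem_append.1 hg with hg | hg
      · exact hgs g hg
      · rw [List.mem_singleton] at hg; subst hg; exact ⟨hp, hq⟩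
    · have himg : ∀ y, y ∈ (x :: C).map (actW (gs ++ [(p, q)])) ↔ y ∈ (r :: codesOf R s).map (actCode p q) := by
        intro y
        constructor
        · intro hy
          obtain ⟨z, hz, rfl⟩ := List.mem_map.1 hy
          rw [actW_append]
          refine List.mem_map.2 ⟨actW gs z, ?_, rfl⟩
          exact List.mem_cons.2 ((hD (actW gs z)).1 (List.mem_map.2 ⟨z, hz, rfl⟩))
        · intro hy
          obtain ⟨z, hz, rfl⟩ := List.mem_map.1 hy
          have hz' : z ∈ (x :: C).map (actW gs) := (hD z).2 (List.mem_cons.1 hz)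
          obtain ⟨u, hu, rfl⟩ := List.mem_map.1 hz'
          exact List.mem_map.2 ⟨u, hu, actW_append gs (p, q) u⟩
      intro y
      rw [himg, ← hcand]
      exact mem_iff_of_masks hmap y

end W4

end Summit.MatrixMultiplication.OmegaCensus
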